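import Literature.RepresentationTheory.HeisenbergGroup.LocalWeilProjective
import HarnessLib

/-!
# Transport of implementers along an isomorphism of Heisenberg groups and an intertwiner of models

Topic `RepresentationTheory/HeisenbergGroup`; namespace `Literature.RepresentationTheory.HeisenbergGroup`. KERNEL
mathematics only (theorems; no definition, no named fact, no `axiom`, no `sorry`).

[MoeglinVignerasWaldspurger1987] Chap. 2 II.1 defines, for a model `(ρ_ψ, S)` of the representation of the Heisenberg
group `H`, the group `S̃p_ψ(W) ⊂ Sp(W) × GL(S)` of pairs `(g, M)` with (A) `M ρ_ψ(h) M⁻¹ = ρ_ψ(g·h)`, and records: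
«À isomorphisme près, il est indépendant de la réalisation de `ρ_ψ`». This file is that independence, written for the
tree's predicate `Implements ρ s M` (`SchrodingerSiegelParabolic.lean`: `∀ h f, M (ρ h f) = ρ (s·h) (M f)`, `s` in
Weil's pseudosymplectic group `PseudoSymplectic B` acting by `s·(v,t) = (σ v, t + f v)`), in the generality in which
it is USED when a model is changed (change of polarisation, MVW Chap. 2 I.7; doubling; reduction of the centre):

**Data.** Two bilinear forms `B₁` (on an `R₁`-module `V₁`) and `B₂` (on an `R₂`-module `V₂`); representations
`ρ₁` of `Heisenberg B₁` on `S₁` and `ρ₂` of `Heisenberg B₂` on `S₂` over a commutative (semi)ring `k`; a map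
`Φ : Heisenberg B₁ → Heisenberg B₂` (a group isomorphism `≃*` in the applications — multiplicativity is never used,
only surjectivity, and only where stated) and a `k`-linear equivalence `T : S₁ ≃ₗ[k] S₂` INTERTWINING `ρ₁` with
`ρ₂ ∘ Φ`:

  (I) `T (ρ₁ h f) = ρ₂ (Φ h) (T f)` for all `h, f` (hypothesis `hT`);

and pseudosymplectic automorphisms `s₁` of `Heisenberg B₁`, `s₂` of `Heisenberg B₂` CORRESPONDING under `Φ`:

  (C) `Φ (s₁ · h) = s₂ · (Φ h)` for all `h` (hypothesis `hs`).

**Results.**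
* §1 (condition (A) is transported by conjugation with `T`): if `M` implements `s₁` for `ρ₁` then
  `T M T⁻¹ = T.symm ≪≫ₗ M ≪≫ₗ T` implements `s₂` for `ρ₂` (`Implements.intertwinerConj`, `Φ` an isomorphism;
  `Implements.intertwinerConj_of_surjective`, `Φ` merely surjective); conversely `T⁻¹ M₂ T = T ≪≫ₗ M₂ ≪≫ₗ T.symm`
  implements `s₁` whenever `M₂` implements `s₂` (`Implements.intertwinerConj_symm`, any `Φ`); `iff` forms; and the
  "commuting square" forms `T ∘ M = M₂ ∘ T ⇒ (M implements s₁ ↔ M₂ implements s₂)`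
  (`Implements.of_intertwiner_comm`, `Implements.of_intertwiner_comm_symm`).
* §2 (uniqueness up to a scalar): if any two implementers of `s₂` for `ρ₂` differ by a unit scalar (MVW II.1 "`M` est
  unique à un scalaire près", taken as a HYPOTHESIS at `s₂` — in the tree it is the predicate
  `ImplementerUniqueUpToScalar ρ₂` when `s₂ = ofSymplectic B₂ g₂`), then for `M` implementing `s₁` and `M₂`
  implementing `s₂`: **`∃ c : kˣ, ∀ f, T (M f) = c • M₂ (T f)`** (`Implements.exists_smul_of_intertwiner`,
  `Implements.exists_smul_of_intertwiner_of_surjective`, `Implements.exists_smul_of_intertwiner_ofSymplectic`; with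
  uniqueness known on the SOURCE model instead — any `Φ` —: `Implements.exists_smul_of_intertwiner_src`,
  `Implements.exists_smul_of_intertwiner_ofSymplectic_src`);
  uniqueness at `s₁` and at `s₂` transfer to each other (`exists_smul_of_implements_of_intertwiner`,
  `exists_smul_of_implements_of_intertwiner_symm`).
* §3 (the tree's predicates): along a map `φ : Sp(V₁,B₁) → Sp(V₂,B₂)` compatible with `Φ` and Weil's sections
  (`Φ ((ofSymplectic B₁ g)·h) = (ofSymplectic B₂ (φ g))·(Φ h)`), `ImplementerUniqueUpToScalar` and
  `ExistsImplementer` pull back from `ρ₂` to `ρ₁` (`ImplementerUniqueUpToScalar.comap_intertwiner` — `Φ`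
  surjective —, `ExistsImplementer.comap_intertwiner`) and push forward when `φ` is surjective
  (`ImplementerUniqueUpToScalar.map_intertwiner`, `ExistsImplementer.map_intertwiner` — `Φ` surjective).
* §4 (symmetry of the data for an isomorphism `Φ`): (I) and (C) for `(Φ, T)` give (I) and (C) for `(Φ⁻¹, T⁻¹)`
  (`intertwiner_symm_apply`, `Heisenberg.PseudoSymplectic.corr_symm`), so every statement may be read backwards.

The special case `S₁ = S₂`, `T = 1`, `Φ = Heisenberg.mapEquiv e` (`e : V₁ ≃ₗ V₂` with `B₂(e·,e·) = B₁`),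
`s = ofSymplectic g` is `ImplementerTransport.lean` §2 (which additionally transports sections and cocycles).

Written for the cell `hodgecm-mathlib` (fan B, rung B-IV, helper H9 of KEY `b4-howe-compact-irreducible`: the doubled
Weil representation is moved to the Schrödinger model adapted to the diagonal Lagrangian `ℓ_Δ` along
`deltaHeisenbergEquiv` and the partial Fourier transform `T`; the implementers of the two models then agree up to
scalars). NOT here: topology, unitarity, sections / cocycles (see `ImplementerTransport.lean`,
`ImplementerCocycle.lean`), any specific model.

## References

* [MoeglinVignerasWaldspurger1987] C. Mœglin, M.-F. Vignéras, J.-L. Waldspurger, *Correspondances de Howe sur un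
  corps p-adique*, LNM 1291 (1987), Chap. 2 I.7, II.1 (A)–(B) (held text p0035: «À isomorphisme près, il est
  indépendant de la réalisation»).
* [Weil1964] A. Weil, *Sur certains groupes d'opérateurs unitaires*, Acta Math. 111 (1964), n° 5, n° 34.
-/

set_option autoImplicit false

noncomputable section

namespace Literature.RepresentationTheory.HeisenbergGroup

/-! ## §1 Transport of condition (A) by conjugation with the intertwiner -/

section Implements

variable {R₁ : Type*} [CommRing R₁] {V₁ : Type*} [AddCommGroup V₁] [Module R₁ V₁] {B₁ : V₁ →ₗ[R₁] V₁ →ₗ[R₁] R₁}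
variable {R₂ : Type*} [CommRing R₂] {V₂ : Type*} [AddCommGroup V₂] [Module R₂ V₂] {B₂ : V₂ →ₗ[R₂] V₂ →ₗ[R₂] R₂}
variable {k : Type*} [CommSemiring k] {S₁ : Type*} [AddCommMonoid S₁] [Module k S₁]
  {S₂ : Type*} [AddCommMonoid S₂] [Module k S₂]
variable {ρ₁ : Representation k (Heisenberg B₁) S₁} {ρ₂ : Representation k (Heisenberg B₂) S₂}

section Function

variable {Φ : Heisenberg B₁ → Heisenberg B₂} {T : S₁ ≃ₗ[k] S₂}
  {s₁ : Heisenberg.PseudoSymplectic B₁} {s₂ : Heisenberg.PseudoSymplectic B₂}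

/-- **pull-back of an implementer**: if `M₂` implements `s₂` for `ρ₂`, then `T⁻¹ M₂ T` (in the tree's left-to-right
composition `T ≪≫ₗ M₂ ≪≫ₗ T.symm`) implements `s₁` for `ρ₁`, for ANY map `Φ` with (I) `T ρ₁(h) = ρ₂(Φ h) T` and
(C) `Φ (s₁·h) = s₂·(Φ h)`. [cite: MoeglinVignerasWaldspurger1987, Chap. 2 II.1 (A)] -/
theorem Implements.intertwinerConj_symm (hT : ∀ (h : Heisenberg B₁) (f : S₁), T (ρ₁ h f) = ρ₂ (Φ h) (T f))
    (hs : ∀ h : Heisenberg B₁, Φ (s₁.act h) = s₂.act (Φ h)) {M₂ : S₂ ≃ₗ[k] S₂} (hM₂ : Implements ρ₂ s₂ M₂) :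
    Implements ρ₁ s₁ (T ≪≫ₗ M₂ ≪≫ₗ T.symm) := by
  intro h f
  simp only [LinearEquiv.trans_apply]
  rw [hT, hM₂, ← hs, LinearEquiv.symm_apply_eq, hT, LinearEquiv.apply_symm_apply]

/-- **push-forward of an implementer** along a SURJECTIVE `Φ`: if `M` implements `s₁` for `ρ₁`, then
`T M T⁻¹ = T.symm ≪≫ₗ M ≪≫ₗ T` implements `s₂` for `ρ₂`. [cite: MoeglinVignerasWaldspurger1987, Chap. 2 II.1 (A)] -/
theorem Implements.intertwinerConj_of_surjective (hΦ : Function.Surjective Φ)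
    (hT : ∀ (h : Heisenberg B₁) (f : S₁), T (ρ₁ h f) = ρ₂ (Φ h) (T f))
    (hs : ∀ h : Heisenberg B₁, Φ (s₁.act h) = s₂.act (Φ h)) {M : S₁ ≃ₗ[k] S₁} (hM : Implements ρ₁ s₁ M) :
    Implements ρ₂ s₂ (T.symm ≪≫ₗ M ≪≫ₗ T) := by
  intro h₂ g
  obtain ⟨h, rfl⟩ := hΦ h₂
  obtain ⟨f, rfl⟩ := T.surjective g
  simp only [LinearEquiv.trans_apply]
  rw [← hT, LinearEquiv.symm_apply_apply, LinearEquiv.symm_apply_apply, hM, hT, hs]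

/-- **commuting-square form of the push-forward**: if `T ∘ M = M₂ ∘ T` and `M` implements `s₁` for `ρ₁`, then `M₂`
implements `s₂` for `ρ₂` (`Φ` surjective). [cite: MoeglinVignerasWaldspurger1987, Chap. 2 II.1 (A)] -/
theorem Implements.of_intertwiner_comm (hΦ : Function.Surjective Φ)
    (hT : ∀ (h : Heisenberg B₁) (f : S₁), T (ρ₁ h f) = ρ₂ (Φ h) (T f))
    (hs : ∀ h : Heisenberg B₁, Φ (s₁.act h) = s₂.act (Φ h)) {M : S₁ ≃ₗ[k] S₁} {M₂ : S₂ ≃ₗ[k] S₂}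
    (hcomm : ∀ f : S₁, T (M f) = M₂ (T f)) (hM : Implements ρ₁ s₁ M) : Implements ρ₂ s₂ M₂ := by
  intro h₂ g
  have h := hM.intertwinerConj_of_surjective hΦ hT hs h₂ g
  simp only [LinearEquiv.trans_apply, hcomm, LinearEquiv.apply_symm_apply] at h
  exact h

/-- **commuting-square form of the pull-back**: if `T ∘ M = M₂ ∘ T` and `M₂` implements `s₂` for `ρ₂`, then `M`
implements `s₁` for `ρ₁` (any `Φ`). [cite: MoeglinVignerasWaldspurger1987, Chap. 2 II.1 (A)] -/
theorem Implements.of_intertwiner_comm_symm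
    (hT : ∀ (h : Heisenberg B₁) (f : S₁), T (ρ₁ h f) = ρ₂ (Φ h) (T f))
    (hs : ∀ h : Heisenberg B₁, Φ (s₁.act h) = s₂.act (Φ h)) {M : S₁ ≃ₗ[k] S₁} {M₂ : S₂ ≃ₗ[k] S₂}
    (hcomm : ∀ f : S₁, T (M f) = M₂ (T f)) (hM₂ : Implements ρ₂ s₂ M₂) : Implements ρ₁ s₁ M := by
  intro h f
  have h' := hM₂.intertwinerConj_symm hT hs h f
  simp only [LinearEquiv.trans_apply, ← hcomm, LinearEquiv.symm_apply_apply] at h'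
  exact h'

/-- **uniqueness up to a scalar, transported**: if any two implementers of `s₂` for `ρ₂` differ by a unit scalar,
`M` implements `s₁` for `ρ₁` and `M₂` implements `s₂` for `ρ₂`, then `T M = c · M₂ T` for a unit `c`
(`Φ` surjective). [cite: MoeglinVignerasWaldspurger1987, Chap. 2 II.1 (A)] -/
theorem Implements.exists_smul_of_intertwiner_of_surjective (hΦ : Function.Surjective Φ)
    (hT : ∀ (h : Heisenberg B₁) (f : S₁), T (ρ₁ h f) = ρ₂ (Φ h) (T f))
    (hs : ∀ h : Heisenberg B₁, Φ (s₁.act h) = s₂.act (Φ h))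
    (hU₂ : ∀ N N' : S₂ ≃ₗ[k] S₂, Implements ρ₂ s₂ N → Implements ρ₂ s₂ N' →
      ∃ c : kˣ, ∀ g : S₂, N' g = (c : k) • N g)
    {M : S₁ ≃ₗ[k] S₁} {M₂ : S₂ ≃ₗ[k] S₂} (hM : Implements ρ₁ s₁ M) (hM₂ : Implements ρ₂ s₂ M₂) :
    ∃ c : kˣ, ∀ f : S₁, T (M f) = (c : k) • M₂ (T f) := by
  obtain ⟨c, hc⟩ := hU₂ M₂ _ hM₂ (hM.intertwinerConj_of_surjective hΦ hT hs)
  refine ⟨c, fun f => ?_⟩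
  simpa only [LinearEquiv.trans_apply, LinearEquiv.symm_apply_apply] using hc (T f)

/-- **uniqueness up to a scalar known on the SOURCE model**: if any two implementers of `s₁` for `ρ₁` differ by
a unit scalar, `M` implements `s₁` for `ρ₁` and `M₂` implements `s₂` for `ρ₂`, then `T M = c · M₂ T` for a unit `c`
— for ANY map `Φ` (no surjectivity needed). [cite: MoeglinVignerasWaldspurger1987, Chap. 2 II.1 (A)] -/
theorem Implements.exists_smul_of_intertwiner_src
    (hT : ∀ (h : Heisenberg B₁) (f : S₁), T (ρ₁ h f) = ρ₂ (Φ h) (T f))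
    (hs : ∀ h : Heisenberg B₁, Φ (s₁.act h) = s₂.act (Φ h))
    (hU₁ : ∀ N N' : S₁ ≃ₗ[k] S₁, Implements ρ₁ s₁ N → Implements ρ₁ s₁ N' →
      ∃ c : kˣ, ∀ f : S₁, N' f = (c : k) • N f)
    {M : S₁ ≃ₗ[k] S₁} {M₂ : S₂ ≃ₗ[k] S₂} (hM : Implements ρ₁ s₁ M) (hM₂ : Implements ρ₂ s₂ M₂) :
    ∃ c : kˣ, ∀ f : S₁, T (M f) = (c : k) • M₂ (T f) := by
  obtain ⟨c, hc⟩ := hU₁ _ M (hM₂.intertwinerConj_symm hT hs) hM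
  refine ⟨c, fun f => ?_⟩
  rw [hc f, map_smul]
  simp only [LinearEquiv.trans_apply, LinearEquiv.apply_symm_apply]

/-- **uniqueness at `s₁` gives uniqueness at `s₂`** (any `Φ`): if any two implementers of `s₁` for `ρ₁` differ by a
unit scalar, so do any two implementers of `s₂` for `ρ₂`. [cite: MoeglinVignerasWaldspurger1987, Chap. 2 II.1 (A)] -/
theorem exists_smul_of_implements_of_intertwiner
    (hT : ∀ (h : Heisenberg B₁) (f : S₁), T (ρ₁ h f) = ρ₂ (Φ h) (T f))
    (hs : ∀ h : Heisenberg B₁, Φ (s₁.act h) = s₂.act (Φ h))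
    (hU₁ : ∀ N N' : S₁ ≃ₗ[k] S₁, Implements ρ₁ s₁ N → Implements ρ₁ s₁ N' →
      ∃ c : kˣ, ∀ f : S₁, N' f = (c : k) • N f)
    (N N' : S₂ ≃ₗ[k] S₂) (hN : Implements ρ₂ s₂ N) (hN' : Implements ρ₂ s₂ N') :
    ∃ c : kˣ, ∀ g : S₂, N' g = (c : k) • N g := by
  obtain ⟨c, hc⟩ := hU₁ _ _ (hN.intertwinerConj_symm hT hs) (hN'.intertwinerConj_symm hT hs)
  refine ⟨c, fun g => T.symm.injective ?_⟩
  rw [map_smul]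
  simpa only [LinearEquiv.trans_apply, LinearEquiv.apply_symm_apply] using hc (T.symm g)

/-- **uniqueness at `s₂` gives uniqueness at `s₁`** (`Φ` surjective): if any two implementers of `s₂` for `ρ₂`
differ by a unit scalar, so do any two implementers of `s₁` for `ρ₁`.
[cite: MoeglinVignerasWaldspurger1987, Chap. 2 II.1 (A)] -/
theorem exists_smul_of_implements_of_intertwiner_symm (hΦ : Function.Surjective Φ)
    (hT : ∀ (h : Heisenberg B₁) (f : S₁), T (ρ₁ h f) = ρ₂ (Φ h) (T f))
    (hs : ∀ h : Heisenberg B₁, Φ (s₁.act h) = s₂.act (Φ h))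
    (hU₂ : ∀ N N' : S₂ ≃ₗ[k] S₂, Implements ρ₂ s₂ N → Implements ρ₂ s₂ N' →
      ∃ c : kˣ, ∀ g : S₂, N' g = (c : k) • N g)
    (N N' : S₁ ≃ₗ[k] S₁) (hN : Implements ρ₁ s₁ N) (hN' : Implements ρ₁ s₁ N') :
    ∃ c : kˣ, ∀ f : S₁, N' f = (c : k) • N f := by
  obtain ⟨c, hc⟩ := hU₂ _ _ (hN.intertwinerConj_of_surjective hΦ hT hs)
    (hN'.intertwinerConj_of_surjective hΦ hT hs)
  refine ⟨c, fun f => T.injective ?_⟩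
  rw [map_smul]
  simpa only [LinearEquiv.trans_apply, LinearEquiv.symm_apply_apply] using hc (T f)

/-- **existence of an implementer pulls back** (any `Φ`). [cite: MoeglinVignerasWaldspurger1987, Chap. 2 II.1 (A)] -/
theorem exists_implements_of_intertwiner_symm
    (hT : ∀ (h : Heisenberg B₁) (f : S₁), T (ρ₁ h f) = ρ₂ (Φ h) (T f))
    (hs : ∀ h : Heisenberg B₁, Φ (s₁.act h) = s₂.act (Φ h)) (hE₂ : ∃ M₂ : S₂ ≃ₗ[k] S₂, Implements ρ₂ s₂ M₂) :
    ∃ M : S₁ ≃ₗ[k] S₁, Implements ρ₁ s₁ M := by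
  obtain ⟨M₂, hM₂⟩ := hE₂
  exact ⟨_, hM₂.intertwinerConj_symm hT hs⟩

/-- **existence of an implementer pushes forward** (`Φ` surjective).
[cite: MoeglinVignerasWaldspurger1987, Chap. 2 II.1 (A)] -/
theorem exists_implements_of_intertwiner (hΦ : Function.Surjective Φ)
    (hT : ∀ (h : Heisenberg B₁) (f : S₁), T (ρ₁ h f) = ρ₂ (Φ h) (T f))
    (hs : ∀ h : Heisenberg B₁, Φ (s₁.act h) = s₂.act (Φ h)) (hE₁ : ∃ M : S₁ ≃ₗ[k] S₁, Implements ρ₁ s₁ M) :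
    ∃ M₂ : S₂ ≃ₗ[k] S₂, Implements ρ₂ s₂ M₂ := by
  obtain ⟨M, hM⟩ := hE₁
  exact ⟨_, hM.intertwinerConj_of_surjective hΦ hT hs⟩

end Function

/-! ### The same for an isomorphism `Φ : Heisenberg B₁ ≃* Heisenberg B₂` -/

section MulEquiv

variable {Φ : Heisenberg B₁ ≃* Heisenberg B₂} {T : S₁ ≃ₗ[k] S₂}
  {s₁ : Heisenberg.PseudoSymplectic B₁} {s₂ : Heisenberg.PseudoSymplectic B₂}

/-- **(a) transport of condition (A)**: for an isomorphism of Heisenberg groups `Φ`, an intertwiner `T` of `ρ₁` with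
`ρ₂ ∘ Φ` and corresponding `s₁ ↔ s₂`: if `M` implements `s₁` for `ρ₁` then `T.symm ≪≫ₗ M ≪≫ₗ T` (`= T M T⁻¹`)
implements `s₂` for `ρ₂`. [cite: MoeglinVignerasWaldspurger1987, Chap. 2 II.1 (A)] -/
theorem Implements.intertwinerConj (hT : ∀ (h : Heisenberg B₁) (f : S₁), T (ρ₁ h f) = ρ₂ (Φ h) (T f))
    (hs : ∀ h : Heisenberg B₁, Φ (s₁.act h) = s₂.act (Φ h)) {M : S₁ ≃ₗ[k] S₁} (hM : Implements ρ₁ s₁ M) :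
    Implements ρ₂ s₂ (T.symm ≪≫ₗ M ≪≫ₗ T) :=
  hM.intertwinerConj_of_surjective Φ.surjective hT hs

/-- `T M T⁻¹` implements `s₂` for `ρ₂` **iff** `M` implements `s₁` for `ρ₁`.
[cite: MoeglinVignerasWaldspurger1987, Chap. 2 II.1 (A)] -/
theorem implements_intertwinerConj_iff (hT : ∀ (h : Heisenberg B₁) (f : S₁), T (ρ₁ h f) = ρ₂ (Φ h) (T f))
    (hs : ∀ h : Heisenberg B₁, Φ (s₁.act h) = s₂.act (Φ h)) (M : S₁ ≃ₗ[k] S₁) :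
    Implements ρ₂ s₂ (T.symm ≪≫ₗ M ≪≫ₗ T) ↔ Implements ρ₁ s₁ M := by
  refine ⟨fun h => ?_, fun h => h.intertwinerConj hT hs⟩
  intro a f
  simpa only [LinearEquiv.trans_apply, LinearEquiv.symm_apply_apply] using h.intertwinerConj_symm hT hs a f

/-- `T⁻¹ M₂ T` implements `s₁` for `ρ₁` **iff** `M₂` implements `s₂` for `ρ₂`.
[cite: MoeglinVignerasWaldspurger1987, Chap. 2 II.1 (A)] -/
theorem implements_intertwinerConj_symm_iff (hT : ∀ (h : Heisenberg B₁) (f : S₁), T (ρ₁ h f) = ρ₂ (Φ h) (T f))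
    (hs : ∀ h : Heisenberg B₁, Φ (s₁.act h) = s₂.act (Φ h)) (M₂ : S₂ ≃ₗ[k] S₂) :
    Implements ρ₁ s₁ (T ≪≫ₗ M₂ ≪≫ₗ T.symm) ↔ Implements ρ₂ s₂ M₂ := by
  refine ⟨fun h => ?_, fun h => h.intertwinerConj_symm hT hs⟩
  intro a g
  simpa only [LinearEquiv.trans_apply, LinearEquiv.apply_symm_apply] using h.intertwinerConj hT hs a g

/-- with `T ∘ M = M₂ ∘ T`: `M` implements `s₁` for `ρ₁` **iff** `M₂` implements `s₂` for `ρ₂`.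
[cite: MoeglinVignerasWaldspurger1987, Chap. 2 II.1 (A)] -/
theorem implements_iff_of_intertwiner_comm (hT : ∀ (h : Heisenberg B₁) (f : S₁), T (ρ₁ h f) = ρ₂ (Φ h) (T f))
    (hs : ∀ h : Heisenberg B₁, Φ (s₁.act h) = s₂.act (Φ h)) {M : S₁ ≃ₗ[k] S₁} {M₂ : S₂ ≃ₗ[k] S₂}
    (hcomm : ∀ f : S₁, T (M f) = M₂ (T f)) : Implements ρ₁ s₁ M ↔ Implements ρ₂ s₂ M₂ :=
  ⟨fun hM => hM.of_intertwiner_comm Φ.surjective hT hs hcomm,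
    fun hM₂ => hM₂.of_intertwiner_comm_symm hT hs hcomm⟩

/-! ## §2 Uniqueness up to a scalar -/

/-- **(b) the transported implementer agrees with any implementer of `s₂` up to a unit scalar**: if any two
implementers of `s₂` for `ρ₂` differ by a unit scalar (MVW II.1 "`M` est unique à un scalaire près", as a
hypothesis at `s₂`), `M` implements `s₁` for `ρ₁` and `M₂` implements `s₂` for `ρ₂`, then
`∃ c : kˣ, ∀ f, T (M f) = c • M₂ (T f)`. [cite: MoeglinVignerasWaldspurger1987, Chap. 2 II.1 (A)] -/
theorem Implements.exists_smul_of_intertwiner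
    (hT : ∀ (h : Heisenberg B₁) (f : S₁), T (ρ₁ h f) = ρ₂ (Φ h) (T f))
    (hs : ∀ h : Heisenberg B₁, Φ (s₁.act h) = s₂.act (Φ h))
    (hU₂ : ∀ N N' : S₂ ≃ₗ[k] S₂, Implements ρ₂ s₂ N → Implements ρ₂ s₂ N' →
      ∃ c : kˣ, ∀ g : S₂, N' g = (c : k) • N g)
    {M : S₁ ≃ₗ[k] S₁} {M₂ : S₂ ≃ₗ[k] S₂} (hM : Implements ρ₁ s₁ M) (hM₂ : Implements ρ₂ s₂ M₂) :
    ∃ c : kˣ, ∀ f : S₁, T (M f) = (c : k) • M₂ (T f) :=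
  hM.exists_smul_of_intertwiner_of_surjective Φ.surjective hT hs hU₂ hM₂

/-- for an isomorphism `Φ`, **uniqueness up to a scalar at `s₁` and at `s₂` are equivalent**.
[cite: MoeglinVignerasWaldspurger1987, Chap. 2 II.1 (A)] -/
theorem implements_unique_iff_of_intertwiner
    (hT : ∀ (h : Heisenberg B₁) (f : S₁), T (ρ₁ h f) = ρ₂ (Φ h) (T f))
    (hs : ∀ h : Heisenberg B₁, Φ (s₁.act h) = s₂.act (Φ h)) :
    (∀ N N' : S₁ ≃ₗ[k] S₁, Implements ρ₁ s₁ N → Implements ρ₁ s₁ N' →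
        ∃ c : kˣ, ∀ f : S₁, N' f = (c : k) • N f) ↔
      ∀ N N' : S₂ ≃ₗ[k] S₂, Implements ρ₂ s₂ N → Implements ρ₂ s₂ N' →
        ∃ c : kˣ, ∀ g : S₂, N' g = (c : k) • N g :=
  ⟨fun hU₁ => exists_smul_of_implements_of_intertwiner hT hs hU₁,
    fun hU₂ => exists_smul_of_implements_of_intertwiner_symm Φ.surjective hT hs hU₂⟩

/-- for an isomorphism `Φ`, **`s₁` has an implementer iff `s₂` has one**.
[cite: MoeglinVignerasWaldspurger1987, Chap. 2 II.1 (A)] -/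
theorem exists_implements_iff_of_intertwiner
    (hT : ∀ (h : Heisenberg B₁) (f : S₁), T (ρ₁ h f) = ρ₂ (Φ h) (T f))
    (hs : ∀ h : Heisenberg B₁, Φ (s₁.act h) = s₂.act (Φ h)) :
    (∃ M : S₁ ≃ₗ[k] S₁, Implements ρ₁ s₁ M) ↔ ∃ M₂ : S₂ ≃ₗ[k] S₂, Implements ρ₂ s₂ M₂ :=
  ⟨exists_implements_of_intertwiner Φ.surjective hT hs, exists_implements_of_intertwiner_symm hT hs⟩

end MulEquiv

end Implements

/-! ## §3 The tree's predicates `ImplementerUniqueUpToScalar`, `ExistsImplementer` over Weil's sections -/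

section Predicates

variable {R₁ : Type*} [CommRing R₁] [Invertible (2 : R₁)] {V₁ : Type*} [AddCommGroup V₁] [Module R₁ V₁]
  {B₁ : V₁ →ₗ[R₁] V₁ →ₗ[R₁] R₁}
variable {R₂ : Type*} [CommRing R₂] [Invertible (2 : R₂)] {V₂ : Type*} [AddCommGroup V₂] [Module R₂ V₂]
  {B₂ : V₂ →ₗ[R₂] V₂ →ₗ[R₂] R₂}
variable {k : Type*} [CommRing k] {S₁ : Type*} [AddCommGroup S₁] [Module k S₁]
  {S₂ : Type*} [AddCommGroup S₂] [Module k S₂]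
variable {ρ₁ : Representation k (Heisenberg B₁) S₁} {ρ₂ : Representation k (Heisenberg B₂) S₂}

section Function

variable {Φ : Heisenberg B₁ → Heisenberg B₂} {T : S₁ ≃ₗ[k] S₂} {φ : symplecticGroup B₁ → symplecticGroup B₂}

omit [Invertible (2 : R₁)] in
/-- **(b) over Weil's section**: `s₂ = ofSymplectic B₂ g₂` and the tree's hypothesis
`ImplementerUniqueUpToScalar ρ₂`; then `T M = c · M₂ T` for `M` implementing `s₁` (for `ρ₁`) and `M₂` implementing
`ofSymplectic B₂ g₂` (for `ρ₂`), `Φ` surjective. [cite: MoeglinVignerasWaldspurger1987, Chap. 2 II.1 (A)] -/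
theorem Implements.exists_smul_of_intertwiner_ofSymplectic_of_surjective (hΦ : Function.Surjective Φ)
    (hT : ∀ (h : Heisenberg B₁) (f : S₁), T (ρ₁ h f) = ρ₂ (Φ h) (T f))
    {s₁ : Heisenberg.PseudoSymplectic B₁} {g₂ : symplecticGroup B₂}
    (hs : ∀ h : Heisenberg B₁, Φ (s₁.act h) = (ofSymplectic B₂ g₂).act (Φ h))
    (hU₂ : ImplementerUniqueUpToScalar ρ₂) {M : S₁ ≃ₗ[k] S₁} {M₂ : S₂ ≃ₗ[k] S₂} (hM : Implements ρ₁ s₁ M)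
    (hM₂ : Implements ρ₂ (ofSymplectic B₂ g₂) M₂) : ∃ c : kˣ, ∀ f : S₁, T (M f) = (c : k) • M₂ (T f) :=
  hM.exists_smul_of_intertwiner_of_surjective hΦ hT hs (hU₂ g₂) hM₂

omit [Invertible (2 : R₂)] in
/-- **(b) over Weil's section, uniqueness known on the SOURCE model**: `s₁ = ofSymplectic B₁ g₁`,
`ImplementerUniqueUpToScalar ρ₁`; then `T M = c · M₂ T` for `M` implementing `ofSymplectic B₁ g₁` (for `ρ₁`) and `M₂`
implementing `s₂` (for `ρ₂`) — any `Φ`. [cite: MoeglinVignerasWaldspurger1987, Chap. 2 II.1 (A)] -/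
theorem Implements.exists_smul_of_intertwiner_ofSymplectic_src
    (hT : ∀ (h : Heisenberg B₁) (f : S₁), T (ρ₁ h f) = ρ₂ (Φ h) (T f))
    {g₁ : symplecticGroup B₁} {s₂ : Heisenberg.PseudoSymplectic B₂}
    (hs : ∀ h : Heisenberg B₁, Φ ((ofSymplectic B₁ g₁).act h) = s₂.act (Φ h))
    (hU₁ : ImplementerUniqueUpToScalar ρ₁) {M : S₁ ≃ₗ[k] S₁} {M₂ : S₂ ≃ₗ[k] S₂}
    (hM : Implements ρ₁ (ofSymplectic B₁ g₁) M) (hM₂ : Implements ρ₂ s₂ M₂) :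
    ∃ c : kˣ, ∀ f : S₁, T (M f) = (c : k) • M₂ (T f) :=
  hM.exists_smul_of_intertwiner_src hT hs (hU₁ g₁) hM₂

/-- **uniqueness of implementers up to scalars pulls back** from `ρ₂` to `ρ₁` along `(Φ, T)` and any map
`φ : Sp(V₁,B₁) → Sp(V₂,B₂)` with `Φ ((ofSymplectic B₁ g)·h) = (ofSymplectic B₂ (φ g))·(Φ h)` (`Φ` surjective).
[cite: MoeglinVignerasWaldspurger1987, Chap. 2 II.1 (A)] -/
theorem ImplementerUniqueUpToScalar.comap_intertwiner (hΦ : Function.Surjective Φ)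
    (hT : ∀ (h : Heisenberg B₁) (f : S₁), T (ρ₁ h f) = ρ₂ (Φ h) (T f))
    (hφ : ∀ (g : symplecticGroup B₁) (h : Heisenberg B₁),
      Φ ((ofSymplectic B₁ g).act h) = (ofSymplectic B₂ (φ g)).act (Φ h))
    (hU₂ : ImplementerUniqueUpToScalar ρ₂) : ImplementerUniqueUpToScalar ρ₁ :=
  fun g N N' hN hN' => exists_smul_of_implements_of_intertwiner_symm hΦ hT (hφ g) (hU₂ (φ g)) N N' hN hN'

/-- **uniqueness of implementers up to scalars pushes forward** from `ρ₁` to `ρ₂` when `φ` is surjective (any `Φ`).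
[cite: MoeglinVignerasWaldspurger1987, Chap. 2 II.1 (A)] -/
theorem ImplementerUniqueUpToScalar.map_intertwiner
    (hT : ∀ (h : Heisenberg B₁) (f : S₁), T (ρ₁ h f) = ρ₂ (Φ h) (T f))
    (hφ : ∀ (g : symplecticGroup B₁) (h : Heisenberg B₁),
      Φ ((ofSymplectic B₁ g).act h) = (ofSymplectic B₂ (φ g)).act (Φ h))
    (hφs : Function.Surjective φ) (hU₁ : ImplementerUniqueUpToScalar ρ₁) : ImplementerUniqueUpToScalar ρ₂ := by
  intro g₂ N N' hN hN'
  obtain ⟨g, rfl⟩ := hφs g₂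
  exact exists_smul_of_implements_of_intertwiner hT (hφ g) (hU₁ g) N N' hN hN'

/-- **existence of implementers pulls back** from `ρ₂` to `ρ₁` (any `Φ`, any compatible `φ`).
[cite: MoeglinVignerasWaldspurger1987, Chap. 2 II.1 (A)] -/
theorem ExistsImplementer.comap_intertwiner
    (hT : ∀ (h : Heisenberg B₁) (f : S₁), T (ρ₁ h f) = ρ₂ (Φ h) (T f))
    (hφ : ∀ (g : symplecticGroup B₁) (h : Heisenberg B₁),
      Φ ((ofSymplectic B₁ g).act h) = (ofSymplectic B₂ (φ g)).act (Φ h))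
    (hE₂ : ExistsImplementer ρ₂) : ExistsImplementer ρ₁ :=
  fun g => exists_implements_of_intertwiner_symm hT (hφ g) (hE₂ (φ g))

/-- **existence of implementers pushes forward** from `ρ₁` to `ρ₂` (`Φ` and `φ` surjective).
[cite: MoeglinVignerasWaldspurger1987, Chap. 2 II.1 (A)] -/
theorem ExistsImplementer.map_intertwiner (hΦ : Function.Surjective Φ)
    (hT : ∀ (h : Heisenberg B₁) (f : S₁), T (ρ₁ h f) = ρ₂ (Φ h) (T f))
    (hφ : ∀ (g : symplecticGroup B₁) (h : Heisenberg B₁),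
      Φ ((ofSymplectic B₁ g).act h) = (ofSymplectic B₂ (φ g)).act (Φ h))
    (hφs : Function.Surjective φ) (hE₁ : ExistsImplementer ρ₁) : ExistsImplementer ρ₂ := by
  intro g₂
  obtain ⟨g, rfl⟩ := hφs g₂
  exact exists_implements_of_intertwiner hΦ hT (hφ g) (hE₁ g)

end Function

section MulEquiv

variable {Φ : Heisenberg B₁ ≃* Heisenberg B₂} {T : S₁ ≃ₗ[k] S₂}

omit [Invertible (2 : R₁)] in
/-- **(b) over Weil's section, `Φ` an isomorphism**: with `ImplementerUniqueUpToScalar ρ₂`, `M` implementing `s₁`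
for `ρ₁` and `M₂` implementing `ofSymplectic B₂ g₂` for `ρ₂` (`Φ (s₁·h) = (ofSymplectic B₂ g₂)·(Φ h)`):
`∃ c : kˣ, ∀ f, T (M f) = c • M₂ (T f)`. [cite: MoeglinVignerasWaldspurger1987, Chap. 2 II.1 (A)] -/
theorem Implements.exists_smul_of_intertwiner_ofSymplectic
    (hT : ∀ (h : Heisenberg B₁) (f : S₁), T (ρ₁ h f) = ρ₂ (Φ h) (T f))
    {s₁ : Heisenberg.PseudoSymplectic B₁} {g₂ : symplecticGroup B₂}
    (hs : ∀ h : Heisenberg B₁, Φ (s₁.act h) = (ofSymplectic B₂ g₂).act (Φ h))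
    (hU₂ : ImplementerUniqueUpToScalar ρ₂) {M : S₁ ≃ₗ[k] S₁} {M₂ : S₂ ≃ₗ[k] S₂} (hM : Implements ρ₁ s₁ M)
    (hM₂ : Implements ρ₂ (ofSymplectic B₂ g₂) M₂) : ∃ c : kˣ, ∀ f : S₁, T (M f) = (c : k) • M₂ (T f) :=
  hM.exists_smul_of_intertwiner_ofSymplectic_of_surjective Φ.surjective hT hs hU₂ hM₂

/-- along an isomorphism `Φ` and a compatible BIJECTION `φ : Sp(V₁,B₁) ≃ Sp(V₂,B₂)`, **uniqueness of implementers
up to scalars for `ρ₁` and for `ρ₂` are equivalent**. [cite: MoeglinVignerasWaldspurger1987, Chap. 2 II.1 (A)] -/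
theorem implementerUniqueUpToScalar_iff_of_intertwiner
    (hT : ∀ (h : Heisenberg B₁) (f : S₁), T (ρ₁ h f) = ρ₂ (Φ h) (T f)) (φ : symplecticGroup B₁ ≃ symplecticGroup B₂)
    (hφ : ∀ (g : symplecticGroup B₁) (h : Heisenberg B₁),
      Φ ((ofSymplectic B₁ g).act h) = (ofSymplectic B₂ (φ g)).act (Φ h)) :
    ImplementerUniqueUpToScalar ρ₁ ↔ ImplementerUniqueUpToScalar ρ₂ :=
  ⟨ImplementerUniqueUpToScalar.map_intertwiner hT hφ φ.surjective,
    ImplementerUniqueUpToScalar.comap_intertwiner Φ.surjective hT hφ⟩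

/-- along an isomorphism `Φ` and a compatible BIJECTION `φ`, **implementers exist for `ρ₁` iff they exist for
`ρ₂`**. [cite: MoeglinVignerasWaldspurger1987, Chap. 2 II.1 (A)] -/
theorem existsImplementer_iff_of_intertwiner
    (hT : ∀ (h : Heisenberg B₁) (f : S₁), T (ρ₁ h f) = ρ₂ (Φ h) (T f)) (φ : symplecticGroup B₁ ≃ symplecticGroup B₂)
    (hφ : ∀ (g : symplecticGroup B₁) (h : Heisenberg B₁),
      Φ ((ofSymplectic B₁ g).act h) = (ofSymplectic B₂ (φ g)).act (Φ h)) :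
    ExistsImplementer ρ₁ ↔ ExistsImplementer ρ₂ :=
  ⟨ExistsImplementer.map_intertwiner Φ.surjective hT hφ φ.surjective,
    ExistsImplementer.comap_intertwiner hT hφ⟩

end MulEquiv

end Predicates

/-! ## §4 Symmetry of the data for an isomorphism `Φ` -/

section Symmetry

variable {R₁ : Type*} [CommRing R₁] {V₁ : Type*} [AddCommGroup V₁] [Module R₁ V₁] {B₁ : V₁ →ₗ[R₁] V₁ →ₗ[R₁] R₁}
variable {R₂ : Type*} [CommRing R₂] {V₂ : Type*} [AddCommGroup V₂] [Module R₂ V₂] {B₂ : V₂ →ₗ[R₂] V₂ →ₗ[R₂] R₂}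
variable {k : Type*} [CommSemiring k] {S₁ : Type*} [AddCommMonoid S₁] [Module k S₁]
  {S₂ : Type*} [AddCommMonoid S₂] [Module k S₂]
variable {ρ₁ : Representation k (Heisenberg B₁) S₁} {ρ₂ : Representation k (Heisenberg B₂) S₂}
variable {Φ : Heisenberg B₁ ≃* Heisenberg B₂} {T : S₁ ≃ₗ[k] S₂}

/-- (I) read backwards: **`T⁻¹` intertwines `ρ₂` with `ρ₁ ∘ Φ⁻¹`**, `T⁻¹ (ρ₂ h₂ g) = ρ₁ (Φ⁻¹ h₂) (T⁻¹ g)`.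
[cite: MoeglinVignerasWaldspurger1987, Chap. 2 II.1 (A)] -/
theorem intertwiner_symm_apply (hT : ∀ (h : Heisenberg B₁) (f : S₁), T (ρ₁ h f) = ρ₂ (Φ h) (T f))
    (h₂ : Heisenberg B₂) (g : S₂) : T.symm (ρ₂ h₂ g) = ρ₁ (Φ.symm h₂) (T.symm g) := by
  rw [LinearEquiv.symm_apply_eq, hT, MulEquiv.apply_symm_apply, LinearEquiv.apply_symm_apply]

/-- (C) read backwards: **`Φ⁻¹ (s₂·h₂) = s₁·(Φ⁻¹ h₂)`**. [cite: Weil1964, n° 5, p. 150] -/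
theorem Heisenberg.PseudoSymplectic.corr_symm {s₁ : Heisenberg.PseudoSymplectic B₁}
    {s₂ : Heisenberg.PseudoSymplectic B₂} (hs : ∀ h : Heisenberg B₁, Φ (s₁.act h) = s₂.act (Φ h))
    (h₂ : Heisenberg B₂) : Φ.symm (s₂.act h₂) = s₁.act (Φ.symm h₂) := by
  rw [MulEquiv.symm_apply_eq, hs, MulEquiv.apply_symm_apply]

/-- (b) read backwards: with uniqueness up to a scalar at `s₁` (for `ρ₁`), `M` implementing `s₁` and `M₂`
implementing `s₂`: `∃ c : kˣ, ∀ g, T⁻¹ (M₂ g) = c • M (T⁻¹ g)`. [cite: MoeglinVignerasWaldspurger1987, Chap. 2 II.1 (A)] -/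
theorem Implements.exists_smul_of_intertwiner_symm
    (hT : ∀ (h : Heisenberg B₁) (f : S₁), T (ρ₁ h f) = ρ₂ (Φ h) (T f))
    {s₁ : Heisenberg.PseudoSymplectic B₁} {s₂ : Heisenberg.PseudoSymplectic B₂}
    (hs : ∀ h : Heisenberg B₁, Φ (s₁.act h) = s₂.act (Φ h))
    (hU₁ : ∀ N N' : S₁ ≃ₗ[k] S₁, Implements ρ₁ s₁ N → Implements ρ₁ s₁ N' →
      ∃ c : kˣ, ∀ f : S₁, N' f = (c : k) • N f)
    {M : S₁ ≃ₗ[k] S₁} {M₂ : S₂ ≃ₗ[k] S₂} (hM : Implements ρ₁ s₁ M) (hM₂ : Implements ρ₂ s₂ M₂) :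
    ∃ c : kˣ, ∀ g : S₂, T.symm (M₂ g) = (c : k) • M (T.symm g) :=
  hM₂.exists_smul_of_intertwiner (Φ := Φ.symm) (T := T.symm) (intertwiner_symm_apply hT)
    (Heisenberg.PseudoSymplectic.corr_symm hs) hU₁ hM

end Symmetry

end Literature.RepresentationTheory.HeisenbergGroup
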